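import Summits.ValiantsHypothesis.ValiantsHypothesis.Theorems.BarrierLeverPriorityPeelingSymmetries

/-!
# Route BarrierLever — priority peeling for TT: derivations are invariant under index equivalences

Helper file (`--supports stmt-ValiantsHypothesis-19761`; cell valiant-natproofs, rung V4, 𝒟-side door
(c); prover val-np-p1 g7). Closes NO item. Completes the symmetry lemmas of `…PriorityPeelingSymmetries`
(p475414: literal relabelings, slot permutations, `PPDerivable.reindex` for permutations of ONE index
type) by transport along an EQUIVALENCE of index types:

* `PPDerivable.mapEquiv` — if `(R, C)` over `ι` is derivable and `ε : ι' ≃ ι`, then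
  `(R ∘ ε, C ∘ ε)` over `ι'` is derivable (induction on the derivation; the pair move's children live on
  the subtypes `{x // β x = false}`, transported by `ε.subtypeEquiv`; the matching becomes `ε⁻¹ f ε`).
* `PPDerivable.of_fin_equiv` — in particular a derivation over `Fin r` yields one over any index type
  equivalent to `Fin r`, so the `Fin r`-indexed rungs (`…LayoutsUpToThree` p478746, `…LayoutsThreeRows`
  p479632, the emitted certificates) apply to configurations indexed by subtypes, as they arise as
  children of pair moves.

WHAT THIS IS NOT: bookkeeping; nothing on 19761 / TT (19152) in general, on crux
stmt-ValiantsHypothesis-14610, or on VP versus VNP.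
-/

-- layout Summits/ValiantsHypothesis/ValiantsHypothesis forces the duplicated namespace component
set_option linter.dupNamespace false

namespace Summit.ValiantsHypothesis.ValiantsHypothesis.Theorems.BarrierLever.PriorityPeeling

/-- **Index equivalences transport derivations.** -/
theorem PPDerivable.mapEquiv {nr nc : ℕ} {ι : Type} [Fintype ι] [DecidableEq ι] {e : ℕ}
    {R : ι → Fin e → Fin nr} {C : ι → Fin e → Fin nc} (h : PPDerivable nr nc ι e R C) :
    ∀ {ι' : Type} [Fintype ι'] [DecidableEq ι'] (ε : ι' ≃ ι),
      PPDerivable nr nc ι' e (fun i => R (ε i)) (fun j => C (ε j)) := by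
  induction h with
  | @rank_zero nr nc ι _ _ hsub R C =>
    intro ι' _ _ ε
    haveI : Subsingleton ι' := ε.subsingleton
    exact PPDerivable.rank_zero _ _
  | rank_one R C hR hC =>
    intro ι' _ _ ε
    exact PPDerivable.rank_one _ _ (hR.comp ε.injective) (hC.comp ε.injective)
  | single R C i₀ hι hR hC =>
    intro ι' _ _ ε
    refine PPDerivable.single _ _ (ε.symm i₀) (fun i => ε.injective ?_) ?_ ?_
    · rw [Equiv.apply_symm_apply]; exact hι (ε i)
    · simpa only [Equiv.apply_symm_apply] using hR
    · simpa only [Equiv.apply_symm_apply] using hC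
  | pair R C ℓ₀ ℓ₁ hℓ b pos hpos huniq P S w grp qφ hφ₀ hφ₁ fp hfp _ _ ih₀ ih₁ =>
    intro ι' _ _ ε
    refine PPDerivable.pair _ _ ℓ₀ ℓ₁ hℓ (fun i => b (ε i)) (fun i => pos (ε i)) (fun i => hpos (ε i))
      (fun i a ha => huniq (ε i) a ha) P S w (fun j => grp (ε j)) (fun j => qφ (ε j))
      (fun j hj => hφ₀ (ε j) hj) (fun j hj => hφ₁ (ε j) hj) (ε.trans (fp.trans ε.symm))
      (fun i => by simp [hfp]) ?_ ?_
    · -- child over {x : ι' // b (ε x) = false} ≃ {x // b x = false}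
      have := ih₀ (ε.subtypeEquiv (p := fun x : ι' => b (ε x) = false) (q := fun x => b x = false)
        (fun _ => Iff.rfl))
      refine (congrArg₂ (PPDerivable _ _ _ _) ?_ ?_).mp this <;> funext i x <;>
        simp [Equiv.subtypeEquiv_apply]
    · have := ih₁ (ε.subtypeEquiv (p := fun x : ι' => ¬ b (ε x) = false) (q := fun x => ¬ b x = false)
        (fun _ => Iff.rfl))
      refine (congrArg₂ (PPDerivable _ _ _ _) ?_ ?_).mp this <;> funext i x <;>
        simp [Equiv.subtypeEquiv_apply]
  | shear R C hC x y hxy aff qx haff hunaff _ ih =>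
    intro ι' _ _ ε
    refine PPDerivable.shear _ _ (fun j => hC (ε j)) x y hxy (fun j => aff (ε j)) (fun j => qx (ε j))
      (fun j hj => haff (ε j) hj) (fun j hj => hunaff (ε j) hj) ?_
    exact ih ε
  | transpose R C _ ih =>
    intro ι' _ _ ε
    exact PPDerivable.transpose _ _ (ih ε)
  | reindex R C σ τ _ ih =>
    intro ι' _ _ ε
    refine PPDerivable.reindex _ _ (ε.trans (σ.trans ε.symm)) (ε.trans (τ.trans ε.symm)) ?_
    have := ih ε
    refine (congrArg₂ (PPDerivable _ _ _ _) ?_ ?_).mp this <;> funext i <;> simp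

/-- A derivation over `Fin r` gives one over any index type equivalent to `Fin r`. -/
theorem PPDerivable.of_fin_equiv {nr nc r e : ℕ} {ι : Type} [Fintype ι] [DecidableEq ι]
    (ε : ι ≃ Fin r) {R : Fin r → Fin e → Fin nr} {C : Fin r → Fin e → Fin nc}
    (h : PPDerivable nr nc (Fin r) e R C) (R' : ι → Fin e → Fin nr) (C' : ι → Fin e → Fin nc)
    (hR : ∀ i, R' i = R (ε i)) (hC : ∀ j, C' j = C (ε j)) : PPDerivable nr nc ι e R' C' := by
  have e1 : R' = fun i => R (ε i) := funext hR
  have e2 : C' = fun j => C (ε j) := funext hC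
  rw [e1, e2]
  exact h.mapEquiv ε

end Summit.ValiantsHypothesis.ValiantsHypothesis.Theorems.BarrierLever.PriorityPeeling
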